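import Summits.ABC.ABC.Theses.DefiniteXi

/-!
# Sketch — crux-ideate stmt-ABC-11336 (XiBound), ideator 1, round 1

First lemmas of the two idea cards (must elaborate; not proved here):

* card `real-quadratic-base-change-xi`: `DefiniteUnramifiedSetupExists` (entry ticket of the
  line: over a real quadratic field there is a totally definite quaternion algebra with NO finite
  ramification, carrying Eichler orders of every level) and the typed shape `BaseChangeXiShape`
  of the transferred crux C⁺ (ξ of the base-changed Frey eigen-system in that Brandt module).
* card `two-adic-redei-depth`: `FreyEisensteinModFour` (the Frey form is Eisenstein mod 4 at
  every good odd prime — trivial ρ̄₂) and the sub-crux `TwoAdicXiBound` (2-primary part of ξ is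
  O(log N)), with the bookkeeping split `XiBound_of_parts_shape`.
-/

namespace Summit.ABC.ABC.Cruxes.XiBound.Ideator1

open Literature.NumberTheory.Automorphic Literature.NumberTheory.EllipticCurves

/-- Card 1, first lemma. For every real quadratic number field `K` there is a totally definite
quaternion algebra `D/K` split at every finite place (Hilbert reciprocity: the two real places
already have even cardinality), and it carries an Eichler `ℤ`-order of every level `M ≥ 1`
(index `[O₁ : O] = M`, the tree's `Brandt.IsEichlerOrder`). -/
def DefiniteUnramifiedSetupExists : Prop :=
  ∀ (K : Type) [Field K] [NumberField K], NumberField.IsTotallyReal K →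
    Module.finrank ℚ K = 2 → ∀ M : ℕ, 0 < M →
    ∃ (D : Type) (_ : Ring D) (_ : Algebra K D),
      IsQuaternionAlgebra K D ∧ IsTotallyDefinite K D ∧ ramifiedPlaces K D = ∅ ∧
      ∃ O : Submodule ℤ D, Brandt.IsEichlerOrder D O M

/-- The eigenvalue system of the base change of `E_(a,b)` to `K = ℚ(√d)` as seen by the
`ℤ`-indexed Brandt matrices `Brandt.matrix O p` of an order over `O_K` (they count right
sub-ideals of `ℤ`-index `p²`, i.e. the `𝔭`-neighbours for the primes `𝔭 ∣ p` of norm `p`):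
`2·a_p(E)` at an odd prime `p ∤ d` where `d` is a square (both primes above `p`), `a_p(E)` at
`p ∣ d` (the ramified prime), `0` at inert `p` (no ideal of norm `p`). The prime `2` is sent to
`0` as well (it is excluded from the eigen-conditions below by putting it into the level). -/
noncomputable def bcSystem (d : ℕ) (lam : ℕ → ℤ) (p : ℕ) : ℤ :=
  open scoped Classical in
  if p = 2 then 0
  else if p ∣ d then lam p
  else if IsSquare ((d : ZMod p)) then 2 * lam p
  else 0

/-- Card 1, transferred crux C⁺ (typed SHAPE; the card explains why C⁺ ⟹ XiBound needs Hida's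
base-change congruence-number formula, not in the tree). For the Frey curve of conductor `N`
there is a small real quadratic field `ℚ(√d)`, `d ≤ C·N^A` squarefree, `d > 1`, such that in
EVERY totally definite quaternion algebra over it with no finite ramification and every Eichler
`ℤ`-order of level `(2N)²` (= norm of the level ideal `2N·O_K`), the `ξ` of the base-changed
eigen-system is `≤ C·(N d)^A`.  `xiOfOrder` has junk value `0` off rank one, which only weakens
this upper bound; the honest content is for the rank-one base-change line (strong multiplicity
one for `GL₂/K`). -/
def BaseChangeXiShape : Prop :=
  ∃ A C : ℝ, ∀ a b : ℤ, IsCoprime a b → a * b * (a + b) ≠ 0 → ∀ (N : ℕ) [NeZero N],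
    (freyCurve a b).conductorNorm ℤ = N →
    ∃ d : ℕ, Squarefree d ∧ 1 < d ∧ (d : ℝ) ≤ C * (N : ℝ) ^ A ∧
      ∀ (K : Type) [Field K] [NumberField K], NumberField.IsTotallyReal K →
        Module.finrank ℚ K = 2 → (∃ x : K, x ^ 2 = (d : K)) →
        ∀ (D : Type) [Ring D] [Algebra K D], IsQuaternionAlgebra K D → IsTotallyDefinite K D →
          ramifiedPlaces K D = ∅ →
          ∀ O : Submodule ℤ D, Brandt.IsEichlerOrder D O ((2 * N) ^ 2) →
            (Brandt.xiOfOrder O (2 * N * d)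
                (bcSystem d fun n => (freyCurve a b).LFunction n) : ℝ) ≤ C * ((N : ℝ) * d) ^ A

/-- Card 2, first lemma (provable now): a Frey–Hellegouarch curve has full rational 2-torsion,
so `4 ∣ #E(𝔽_p) = p + 1 − a_p` at every odd prime of good reduction: the Frey newform is
Eisenstein modulo 4, i.e. `ρ̄_(E,2)` is trivial — the residual representation whose 2-adic
deformation theory (Koch's pro-2 presentation of `G_(ℚ,S)(2)`, Rédei symbols of the primes of
`abc`) the card proposes to use. `a_p` is read off Mathlib's `WeierstrassCurve.LFunction`. -/
def FreyEisensteinModFour : Prop :=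
  ∀ a b : ℤ, IsCoprime a b → a * b * (a + b) ≠ 0 → ∀ p : ℕ, p.Prime → p ≠ 2 →
    ¬ (p : ℤ) ∣ a * b * (a + b) →
    (4 : ℤ) ∣ (p : ℤ) + 1 - (freyCurve a b).LFunction p

/-- Card 2, sub-crux C₂ = the 2-primary slice of XiBound: the 2-adic valuation of the definite
congruence number of a Frey curve is `O(log N)` (equivalently its 2-part is polynomial in `N`),
for every admissible `N⁻`.  Junk values of `brandtXi` (`0`) have `factorization 2 = 0`. -/
def TwoAdicXiBound : Prop :=
  ∃ A C : ℝ, ∀ a b : ℤ, IsCoprime a b → a * b * (a + b) ≠ 0 → ∀ (N : ℕ) [NeZero N],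
    (freyCurve a b).conductorNorm ℤ = N → ∀ Nm : ℕ, Odd Nm → Squarefree Nm →
    Odd Nm.primeFactors.card → Nm ∣ N →
    (((brandtXi (N / Nm) Nm fun n => (freyCurve a b).LFunction n).factorization 2 : ℕ) : ℝ)
      ≤ A * Real.log N + C

/-- The complementary slice: the odd part of `ξ` is polynomial (`ordCompl[2] ξ = ξ / 2^(v₂ ξ)`). -/
def OddPartXiBound : Prop :=
  ∃ A C : ℝ, ∀ a b : ℤ, IsCoprime a b → a * b * (a + b) ≠ 0 → ∀ (N : ℕ) [NeZero N],
    (freyCurve a b).conductorNorm ℤ = N → ∀ Nm : ℕ, Odd Nm → Squarefree Nm →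
    Odd Nm.primeFactors.card → Nm ∣ N →
    ((brandtXi (N / Nm) Nm fun n => (freyCurve a b).LFunction n) /
        2 ^ ((brandtXi (N / Nm) Nm fun n => (freyCurve a b).LFunction n).factorization 2) : ℝ)
      ≤ C * (N : ℝ) ^ A

/-- Bookkeeping shape (elementary real arithmetic: `ξ = 2^(v₂ ξ) · oddpart`, `2^(A log N + C) =
e^C' · N^(A log 2)`): the two slices reassemble the crux. Stated, not proved, here. -/
def XiBound_of_parts_shape : Prop :=
  TwoAdicXiBound → OddPartXiBound → Summit.ABC.ABC.Theses.DefiniteXi.XiBound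

end Summit.ABC.ABC.Cruxes.XiBound.Ideator1
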